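import Literature.AnabelianGeometry.EtaleTheta.KummerDataYCoord
import Literature.AnabelianGeometry.EtaleTheta.Discharge.Sec1Prop15iiOfCoreSection
import HarnessLib

/-!
# [EtTh] Prop. 1.5 (i)/(ii) for a section Kummer datum whose coordinate classes come from a `y`-coordinate kit:
# the (b)-clauses from «`ŷ` vanishes on `Δ_Θ`», and the full rows from a kit + ONE lift of `log(Θ)` (proof-only)

Mochizuki, *The étale theta function …*, Publ. RIMS **45** (2009) [EtTh], §1, Prop. 1.5 (i)(ii), PRIMS PDF p. 23
[cite: MochizukiEtTh2009, Prop 1.5 p.23]: "`F¹/F² = … = Ẑ·log(U)`", "`F̈¹/F̈² = … = Ẑ·log(Ü)`" — the coordinate classes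
lie in `F¹` (resp. `F̈¹`), i.e. die on `Δ_Θ`.

PROOF-ONLY file (abc-iut cell, layer L2, R78 cluster; seat abc-iut-L6-d5 gen 4, the GENERIC tail of row R184
«Prop 1.5 (ii) FACT → THEOREM»; no definition, no instance, no `Prop` fact). Over abc-iut-w5-d171's GENERIC
`ThetaSetting.YCoordKit` (`KummerDataYCoord.lean`: `K.logU = [h ↦ ι(ŷ h)]`, `K.logUdd = [h ↦ ι(ŷ h / 2)]`), his
`KummerCore`, abc-iut-L2-t6's `KummerCore.toKummerDataOfSection` and this seat's `Sec1Prop15iiOfCoreSection` — BY NAME.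
For ANY theta setting `D`:

* `YCoordKit.logU_mem_F1_of_y_eq_one`, `YCoordKit.logUdd_mem_Fdd1_of_y_eq_one` — if `ŷ` VANISHES on `Δ_Θ` then
  `K.logU ∈ F¹` and `K.logUdd ∈ F̈¹` (the `Ÿ`-twin of abc-iut-w5-d181's `YCoordKit.res_deltaTheta_logU`; the halved
  class: `ŷ d = 1 ⇒ ŷ d / 2 = 1`);
* **`KummerCore.prop15ii_ofSection_of_kit`**, **`KummerCore.prop15i_ofSection_of_kit`**, `…_and_…` — for a Kummer
  core `C` whose coordinate classes ARE a kit's (`C.logUdd = K.logUdd`, resp. `C.logU = K.logU` — definitional at the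
  R78 models F6/F6q), a continuous Galois section `s`, and ONE lift of `log(Θ)` to `(Π^tp_Ÿ)^Θ` (resp. `(Π^tp_Y)^Θ`),
  the typed `Prop15ii` (resp. `Prop15i`) of `C.toKummerDataOfSection s …` HOLDS — so at any model built from a kit
  (stage 1 `modelχ`, stage 2 `modelχq`, …) the two FACT-LIST rows F-2502/F-2503 reduce to: the kit, `ŷ|_{Δ_Θ} = 0`,
  and a `z`-lift (abc-iut-L2-t6's named `zClassYddχ(q)` or this seat's `exists_res_eq_logTheta_gtpYdd_modelχ(q)`).

HONEST FRAMING: theorems about the typed interface and its class-(b) constructions; nothing of [EtTh] is asserted;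
typed ≠ proved; no side is taken on [IUTchIII] Cor. 3.12.
-/

noncomputable section

namespace Literature.AnabelianGeometry.EtaleTheta

open Literature.AnabelianGeometry.SemiGraphs
open scoped IsMulCommutative

namespace ThetaSetting

variable {p : ℕ} [Fact p.Prime] {D : ThetaSetting p}

/-- `Δ_Θ` acts trivially on itself (it is commutative, root axiom `ker_thetaToEll_comm`) — local copy, in the
`MonoidHom.id`-action shape of `ContH1.res_mk_eq_one_iff_of_conj_trivial`, of
`ThetaSetting.conjNormal_eq_of_mem_deltaTheta` (`Discharge/Sec2GeometricConjClasses.lean`). [cite: MochizukiEtTh2009, §1 p.12] -/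
private theorem conjNormal_id_eq_of_mem_deltaTheta (D : ThetaSetting p) :
    ∀ n ∈ D.DeltaTheta, ∀ a : D.DeltaTheta, MulAut.conjNormal (MonoidHom.id D.GtpTheta n) a = a := by
  intro n hn a
  apply Subtype.ext
  rw [MulAut.conjNormal_apply, MonoidHom.id_apply, ← D.ker_thetaToEll_comm a.1 a.2 n hn, mul_inv_cancel_right]

namespace YCoordKit

variable (K : D.YCoordKit)

/-- **`log(U) ∈ F¹`** for a kit whose `y`-coordinate vanishes on `Δ_Θ` (abc-iut-w5-d181's
`YCoordKit.res_deltaTheta_logU`, in the `F1`-membership shape of abc-iut-L2-t1's `Prop15i`).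
[cite: MochizukiEtTh2009, Prop 1.5 (i) p.23] -/
theorem logU_mem_F1_of_y_eq_one (hC : D.Compat) (hy0 : ∀ d : D.GtpTheta, d ∈ D.DeltaTheta → K.y d = 1) :
    K.logU ∈ F1 hC := by
  refine (ContH1.res_mk_eq_one_iff_of_conj_trivial _ (conjNormal_id_eq_of_mem_deltaTheta D) _ _).mpr fun d => ?_
  show K.iota (K.y (d : D.GtpTheta)) = 1
  rw [hy0 d d.2, map_one]

/-- **`log(Ü) ∈ F̈¹`** for a kit whose `y`-coordinate vanishes on `Δ_Θ` (the halved class dies too: `ŷ d / 2 = 1`).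
[cite: MochizukiEtTh2009, Prop 1.5 (ii) p.23] -/
theorem logUdd_mem_Fdd1_of_y_eq_one (hC : D.Compat) (hy0 : ∀ d : D.GtpTheta, d ∈ D.DeltaTheta → K.y d = 1) :
    K.logUdd ∈ Fdd1 hC := by
  refine (ContH1.res_mk_eq_one_iff_of_conj_trivial _ (conjNormal_id_eq_of_mem_deltaTheta D) _ _).mpr fun d => ?_
  show K.iota (SettingModel.half ⟨K.y (d : D.GtpTheta), _⟩) = 1
  have h1 : (⟨K.y (d : D.GtpTheta), K.y_even _ ((hC.deltaTheta_le_DtpYddTheta.trans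
      (Subgroup.map_mono inf_le_left)) d.2)⟩ : SettingModel.sqHom.range) = 1 :=
    Subtype.ext (hy0 d d.2)
  rw [h1, map_one, map_one]

end YCoordKit

namespace KummerCore

variable (C : D.KummerCore) (K : D.YCoordKit)
  (s : GQp p →* D.PiTemp) (hs : Continuous s) (hsec : ∀ σ : GQp p, D.aug (s σ) = σ)
  (hsY : D.GK.map s ≤ D.GtpY) (hsYdd : D.GKdd.map s ≤ D.GtpYdd) [T2Space D.GtpTheta]

include hs hsec in
/-- **[EtTh] Prop. 1.5 (ii) for a section Kummer datum built from a `y`-coordinate kit**: a Kummer core `C` with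
`C.logUdd = K.logUdd`, a continuous Galois section `s`, ONE lift `x` of `log(Θ)` to `(Π^tp_Ÿ)^Θ`, and `ŷ|_{Δ_Θ} = 0` give
`Prop15ii (C.toKummerDataOfSection s …) hC` — all three clauses. [cite: MochizukiEtTh2009, Prop 1.5 (ii) p.23] -/
theorem prop15ii_ofSection_of_kit (hC : D.Compat) (hK : C.logUdd = K.logUdd)
    (hy0 : ∀ d : D.GtpTheta, d ∈ D.DeltaTheta → K.y d = 1)
    (x : D.H1Theta (D.GtpYdd.map D.toTheta))
    (hx : ContH1.res (MonoidHom.id D.GtpTheta) D.DeltaTheta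
      (hC.deltaTheta_le_DtpYddTheta.trans (Subgroup.map_mono inf_le_left)) x = D.logTheta) :
    Prop15ii (C.toKummerDataOfSection s hs hsec hsY hsYdd) hC :=
  C.prop15ii_ofSection_of_res_eq_logTheta s hs hsec hsY hsYdd hC x hx
    (hK ▸ K.logUdd_mem_Fdd1_of_y_eq_one hC hy0)

include hs hsec in
/-- **[EtTh] Prop. 1.5 (i) for a section Kummer datum built from a `y`-coordinate kit** (`C.logU = K.logU`, a lift of
`log(Θ)` to `(Π^tp_Y)^Θ`, `ŷ|_{Δ_Θ} = 0`). [cite: MochizukiEtTh2009, Prop 1.5 (i) p.23] -/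
theorem prop15i_ofSection_of_kit (hC : D.Compat) (hK : C.logU = K.logU)
    (hy0 : ∀ d : D.GtpTheta, d ∈ D.DeltaTheta → K.y d = 1)
    (x : D.H1Theta (D.GtpY.map D.toTheta))
    (hx : ContH1.res (MonoidHom.id D.GtpTheta) D.DeltaTheta
      (hC.deltaTheta_le_DtpYTheta.trans (Subgroup.map_mono inf_le_left)) x = D.logTheta) :
    Prop15i (C.toKummerDataOfSection s hs hsec hsY hsYdd) hC :=
  ⟨C.res_deltaTheta_surjective_of_res_eq_logTheta _ x hx,
    (by rw [show (C.toKummerDataOfSection s hs hsec hsY hsYdd).logU = K.logU from hK]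
        exact K.logU_mem_F1_of_y_eq_one hC hy0),
    C.F2_eq_range_kumY_ofSection s hs hsec hsY hsYdd⟩

include hs hsec in
/-- **Both rows from a kit and ONE lift of `log(Θ)` to `(Π^tp_Y)^Θ`** (restricted to `Ÿ` for (ii)).
[cite: MochizukiEtTh2009, Prop 1.5 p.23] -/
theorem prop15i_and_prop15ii_ofSection_of_kit (hC : D.Compat) (hKU : C.logU = K.logU) (hKUdd : C.logUdd = K.logUdd)
    (hy0 : ∀ d : D.GtpTheta, d ∈ D.DeltaTheta → K.y d = 1)
    (x : D.H1Theta (D.GtpY.map D.toTheta))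
    (hx : ContH1.res (MonoidHom.id D.GtpTheta) D.DeltaTheta
      (hC.deltaTheta_le_DtpYTheta.trans (Subgroup.map_mono inf_le_left)) x = D.logTheta) :
    Prop15i (C.toKummerDataOfSection s hs hsec hsY hsYdd) hC ∧
      Prop15ii (C.toKummerDataOfSection s hs hsec hsY hsYdd) hC :=
  ⟨C.prop15i_ofSection_of_kit K s hs hsec hsY hsYdd hC hKU hy0 x hx,
    C.prop15ii_ofSection_of_kit K s hs hsec hsY hsYdd hC hKUdd hy0
      (ContH1.res (MonoidHom.id D.GtpTheta) D.DeltaTheta D.GtpYddTheta_le x)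
      ((ContH1.res_res _ _ x).trans hx)⟩

end KummerCore

end ThetaSetting

end Literature.AnabelianGeometry.EtaleTheta

end
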